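import Summits.ResolutionOfSingularities.ResolutionOfSingularities.Theorems.PurelyInseparableDim4ChartAtlasSNCFarRepairReadingW
import Summits.ResolutionOfSingularities.ResolutionOfSingularities.Theorems.PurelyInseparableDim4ChartAtlasSNCFarRepairWPairs
import HarnessLib

/-!
# Purely inseparable four-folds `z^p + F(x₁, …, x₄)`: AFTER THE FAR-RESONANCE REPAIR EVERY RESONANT MEMBER HAS LEFT THE ESCAPING CENTRE —
# at any number of heights, on the chart model and on the stage `W` (cell `res-dim4-pi`, typ-2 g8; HANDOFF g7 OPEN 4, support-level complement of
# `farRepair_reading_W_pairs`: the members at the repaired heights need NO letter in the new node's dictionary)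

[OURS · counted 0] (D-0157 DOOR 2; DR-157-C.) p723327 proved, for ONE height `h`, that a far quadric resonant at `h` reads `(y_k (y_j − (−h)) + β)·𝒪`
on the chart of the repaired centre and that this MISSES `V(y_0, y_T)`. Here: the SUPPORT-LEVEL statement for the one-step repair at any finite list
of heights `hs` (the member resonant at ANY `h ∈ hs` misses the strict transform of the centre — blow up `C_h` first: Literature
`IsBlowup.exists_comp_eq_of_mul` after reordering the product, then `TransformCompDisjoint`), and its transport to the stage `W` (setting of p720641,
pair-list boundary): PROVED here (no `sorry`, no new axiom):

* `prod_heights_eq_mul_erase` — `C(hs) = C_h · C(hs.erase h)` for `h ∈ hs`;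
* `disjoint_support_strictTransform_resonant_heights` — chart model: for ANY blowing up `τ` of `𝔸⁵` along `C(hs)` and a natural-frame far quadric
  `((y_k + β)·y_j − 0·y_k + d)·𝒪` with `k ∈ T`, `β ≠ 0`, `d + β·h = 0` for some `h ∈ hs`: `V(St_τ D) ∩ V(St_τ V(y_0, y_T)) = ∅`;
* `disjoint_support_strictTransform_farHyperplane_heights` — the same for the index-`j` far hyperplane `(y_j + a)·𝒪` with `−a ∈ hs`;
* **`disjoint_support_strictTransform_resonant_W_pairs`** — on `W`: for a far pair `(k, d) ∈ L` (`k ∈ S ∩ S'`, `k ≠ j`, `d ≠ 0`, `b_k ≠ 0`) whose height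
  `−d/b_k` is in `hs`, and ANY blowing up `τ : W″ → W` along `C_W`: `V(St_τ(St_π V(x_k + d))) ∩ V(St_τ Zc) = ∅`;
* **`disjoint_support_strictTransform_farHyperplane_W_pairs`** — the same for a far pair `(j, c)`, `c ≠ 0`, `−c ∈ hs`.

WORDS: «after the repair at the heights `hs`, no old member that met `Zc` only at those heights meets the new centre `St(Zc)` anywhere on `W″`».
Nothing here is a statement about resolution of singularities in dimension ≥ 4 / characteristic `p` (NOT proved anywhere in this programme).
bears_on: LADDER-RESOLUTION:D157-DOOR2 (res-dim4-pi). Supports stmt-ResolutionOfSingularities-16155 (helper).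
-/

-- every declaration of this summit lives under `Summit.ResolutionOfSingularities.ResolutionOfSingularities`
-- (summit = problem), which the duplicate-namespace linter flags; house convention (cf. the Target file).
set_option linter.dupNamespace false

noncomputable section

open MvPolynomial CategoryTheory AlgebraicGeometry Opposite TopologicalSpace
open AlgebraicGeometry.Scheme.IdealSheafData (ofIdealTop vanishingIdeal)

namespace Summit.ResolutionOfSingularities.ResolutionOfSingularities.Theorems.PIDim4

open Literature.AlgebraicGeometry.Resolution
open Literature.AlgebraicGeometry.Resolution.Hauser2010
open Literature.AlgebraicGeometry.Resolution.AffinePointBlowup (P A γ coord Wtop ξ)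
open Literature.Barriers.ResolutionOfSingularities

namespace ChartDictionary

/-! ## §1 Chart model -/

section Model

variable {K : Type} [Field K] {T : Finset (Fin 4)} {j : Fin 4} {V' : Scheme.{0}} {τ : V' ⟶ P 4 K}

/-- **`C(hs) = C_h · C(hs.erase h)`** for `h ∈ hs` (the product of ideal sheaves is commutative). -/
theorem prod_heights_eq_mul_erase [DecidableEq K] (hs : List K) {h : K} (hh : h ∈ hs) :
    (hs.map fun h' => (AffineCoordBlowup.𝓘Λ 4 K (insert 0 (Fin.succ '' ((insert j T : Finset (Fin 4)) : Set (Fin 4))))).comap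
      (Spec.map (CommRingCat.ofHom ((AffinePointBlowup.translateEquiv (n := 4) (Pi.single j.succ (-h')) : A 4 K ≃ₐ[K] A 4 K) :
        A 4 K →+* A 4 K)))).prod =
      (AffineCoordBlowup.𝓘Λ 4 K (insert 0 (Fin.succ '' ((insert j T : Finset (Fin 4)) : Set (Fin 4))))).comap
        (Spec.map (CommRingCat.ofHom ((AffinePointBlowup.translateEquiv (n := 4) (Pi.single j.succ (-h)) : A 4 K ≃ₐ[K] A 4 K) :
          A 4 K →+* A 4 K))) *
      ((hs.erase h).map fun h' => (AffineCoordBlowup.𝓘Λ 4 K (insert 0 (Fin.succ '' ((insert j T : Finset (Fin 4)) : Set (Fin 4))))).comap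
        (Spec.map (CommRingCat.ofHom ((AffinePointBlowup.translateEquiv (n := 4) (Pi.single j.succ (-h')) : A 4 K ≃ₐ[K] A 4 K) :
          A 4 K →+* A 4 K)))).prod := by
  rw [((List.perm_cons_erase hh).map _).prod_eq, List.map_cons, List.prod_cons]

/-- **A RESONANT far quadric misses the strict transform of the escaping centre after the repair AT ANY NUMBER OF HEIGHTS** (chart model): `τ` ANY
blowing up of `𝔸⁵` along `C(hs)`, `D = ((y_k + β)·y_j − 0·y_k + d)·𝒪` with `k ∈ T`, `β ≠ 0`, `d + β·h = 0`, `h ∈ hs`. Proof: blow up `C_h` first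
(`τ = τ₂ ≫ τ₁`); `St_{τ₁} D` misses `St_{τ₁} V(y_0, y_T)` (the latter lives on the `y_j`-chart of `τ₁ ≫ ψ_{−h}`, where p723327 reads both); strict
transforms along `τ₂` lie over those. -/
theorem disjoint_support_strictTransform_resonant_heights [DecidableEq K] (hjT : j ∉ T) (hs : List K) (hnd : hs.Nodup) {h : K} (hh : h ∈ hs)
    {k : Fin 4} (hkT : k ∈ T) {β d : K} (hβ : β ≠ 0) (hres : d + β * h = 0)
    (hτ : IsBlowup τ (hs.map fun h' => (AffineCoordBlowup.𝓘Λ 4 K (insert 0 (Fin.succ '' ((insert j T : Finset (Fin 4)) : Set (Fin 4))))).comap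
      (Spec.map (CommRingCat.ofHom ((AffinePointBlowup.translateEquiv (n := 4) (Pi.single j.succ (-h')) : A 4 K ≃ₐ[K] A 4 K) :
        A 4 K →+* A 4 K)))).prod) :
    Disjoint
      ((strictTransformIdeal τ (hs.map fun h' => (AffineCoordBlowup.𝓘Λ 4 K (insert 0 (Fin.succ '' ((insert j T : Finset (Fin 4)) :
        Set (Fin 4))))).comap (Spec.map (CommRingCat.ofHom ((AffinePointBlowup.translateEquiv (n := 4) (Pi.single j.succ (-h')) :
          A 4 K ≃ₐ[K] A 4 K) : A 4 K →+* A 4 K)))).prod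
        (ofIdealTop (Ideal.span {(γ 4 K).symm ((X k.succ + C β) * X j.succ - C (0 : K) * X k.succ + C d)}))).support : Set V')
      ((strictTransformIdeal τ (hs.map fun h' => (AffineCoordBlowup.𝓘Λ 4 K (insert 0 (Fin.succ '' ((insert j T : Finset (Fin 4)) :
        Set (Fin 4))))).comap (Spec.map (CommRingCat.ofHom ((AffinePointBlowup.translateEquiv (n := 4) (Pi.single j.succ (-h')) :
          A 4 K ≃ₐ[K] A 4 K) : A 4 K →+* A 4 K)))).prod
        (AffineCoordBlowup.𝓘Λ 4 K (insert 0 (Fin.succ '' (T : Set (Fin 4)))))).support : Set V') := by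
  set Λ : Set (Fin (4 + 1)) := insert 0 (Fin.succ '' ((insert j T : Finset (Fin 4)) : Set (Fin 4))) with hΛ
  set Cf : K → Scheme.IdealSheafData (P 4 K) := fun h' => (AffineCoordBlowup.𝓘Λ 4 K Λ).comap
    (Spec.map (CommRingCat.ofHom ((AffinePointBlowup.translateEquiv (n := 4) (Pi.single j.succ (-h')) : A 4 K ≃ₐ[K] A 4 K) :
      A 4 K →+* A 4 K))) with hCf
  -- reorder: blow up `C_h` first
  have heq : (hs.map Cf).prod = Cf h * ((hs.erase h).map Cf).prod := prod_heights_eq_mul_erase hs hh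
  rw [heq] at hτ ⊢
  have hnh : h ∉ hs.erase h := hnd.not_mem_erase
  have hdisj : Disjoint ((Cf h).support : Set (P 4 K)) (((hs.erase h).map Cf).prod.support : Set (P 4 K)) := disjoint_support_heights hnh
  obtain ⟨X₁, τ₁, τ₂, hτ₁, hτ₂, rfl⟩ := hτ.exists_comp_eq_of_mul
  haveI : IsLocallyNoetherian X₁ := hτ₁.isLocallyNoetherian
  haveI : IsLocallyNoetherian V' := hτ₂.isLocallyNoetherian
  rw [IsBlowup.strictTransformIdeal_comp_of_disjoint hτ₂ hdisj, IsBlowup.strictTransformIdeal_comp_of_disjoint hτ₂ hdisj]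
  refine Set.disjoint_left.mpr fun x hxD hxZ => ?_
  have hyD := mem_support_of_mem_support_strictTransformIdeal hxD
  have hyZ := mem_support_of_mem_support_strictTransformIdeal hxZ
  -- `St_{τ₁} V(y_0, y_T)` lives on the `y_j`-chart of `τ₁ ≫ ψ_{−h}`
  have hτ₁' : IsBlowup (τ₁ ≫ Spec.map (CommRingCat.ofHom ((AffinePointBlowup.translateEquiv (n := 4) (Pi.single j.succ (-h)) :
      A 4 K ≃ₐ[K] A 4 K) : A 4 K →+* A 4 K))) (AffineCoordBlowup.𝓘Λ 4 K Λ) := isBlowup_comp_spec_translate hτ₁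
  have hZeq : strictTransformIdeal τ₁ (Cf h) (AffineCoordBlowup.𝓘Λ 4 K (insert 0 (Fin.succ '' (T : Set (Fin 4))))) =
      strictTransformIdeal (τ₁ ≫ Spec.map (CommRingCat.ofHom ((AffinePointBlowup.translateEquiv (n := 4) (Pi.single j.succ (-h)) :
        A 4 K ≃ₐ[K] A 4 K) : A 4 K →+* A 4 K))) (AffineCoordBlowup.𝓘Λ 4 K Λ) (AffineCoordBlowup.𝓘Λ 4 K (insert 0 (Fin.succ '' (T : Set (Fin 4))))) := by
    rw [strictTransformIdeal_comp_base, comap_spec_translate_𝓘Λ_centre hjT]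
  have hchart : τ₂ x ∈ Set.range (AffineCoordBlowup.chartImm hτ₁' (succ_mem_centreVars (Finset.mem_insert_self j T))) := by
    have h1 : τ₂ x ∈ ((strictTransformIdeal (τ₁ ≫ Spec.map (CommRingCat.ofHom ((AffinePointBlowup.translateEquiv (n := 4)
        (Pi.single j.succ (-h)) : A 4 K ≃ₐ[K] A 4 K) : A 4 K →+* A 4 K))) (AffineCoordBlowup.𝓘Λ 4 K Λ)
        (AffineCoordBlowup.𝓘Λ 4 K (insert 0 (Fin.succ '' (T : Set (Fin 4)))))).support : Set X₁) := by
      rw [← hZeq]; exact hyZ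
    exact support_strictTransform_escapingCentre_after_farRepair_subset hτ₁' h1
  obtain ⟨y, hy⟩ := hchart
  -- read both on the chart: the resonant reading misses `V(y_0, y_T)`
  have hyD' : y ∈ ((ofIdealTop (Ideal.span {(γ 4 K).symm (X k.succ * (X j.succ - C (-h)) + C β)})).support : Set (P 4 K)) := by
    rw [← strictTransform_farQuadric_resonant_height hτ₁ hjT hkT hβ hres]
    exact (mem_support_comap_iff _ _ y).mpr (hy ▸ hyD)
  have hyZ' : y ∈ (AffineCoordBlowup.CΛ 4 K (insert 0 (Fin.succ '' (T : Set (Fin 4)))) : Set (P 4 K)) := by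
    rw [← AffineCoordBlowup.support_𝓘Λ, ← comap_chartImm_strictTransform_escapingCentre_after_farRepair hjT hτ₁', ← hZeq]
    exact (mem_support_comap_iff _ _ y).mpr (hy ▸ hyZ)
  exact (disjoint_support_resonantReading_CΛ (T := T) (j := j) hkT hβ h).le_bot ⟨hyD', hyZ'⟩

/-- **The index-`j` far hyperplane at a repaired height misses the strict transform of the escaping centre** (chart model, any number of heights):
`D = (y_j + a)·𝒪` with `−a ∈ hs`. -/
theorem disjoint_support_strictTransform_farHyperplane_heights [DecidableEq K] (hjT : j ∉ T) (hs : List K) (hnd : hs.Nodup) {a : K} (ha : -a ∈ hs)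
    (hτ : IsBlowup τ (hs.map fun h' => (AffineCoordBlowup.𝓘Λ 4 K (insert 0 (Fin.succ '' ((insert j T : Finset (Fin 4)) : Set (Fin 4))))).comap
      (Spec.map (CommRingCat.ofHom ((AffinePointBlowup.translateEquiv (n := 4) (Pi.single j.succ (-h')) : A 4 K ≃ₐ[K] A 4 K) :
        A 4 K →+* A 4 K)))).prod) :
    Disjoint
      ((strictTransformIdeal τ (hs.map fun h' => (AffineCoordBlowup.𝓘Λ 4 K (insert 0 (Fin.succ '' ((insert j T : Finset (Fin 4)) :
        Set (Fin 4))))).comap (Spec.map (CommRingCat.ofHom ((AffinePointBlowup.translateEquiv (n := 4) (Pi.single j.succ (-h')) :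
          A 4 K ≃ₐ[K] A 4 K) : A 4 K →+* A 4 K)))).prod
        (ofIdealTop (Ideal.span {(γ 4 K).symm (X j.succ + C a)}))).support : Set V')
      ((strictTransformIdeal τ (hs.map fun h' => (AffineCoordBlowup.𝓘Λ 4 K (insert 0 (Fin.succ '' ((insert j T : Finset (Fin 4)) :
        Set (Fin 4))))).comap (Spec.map (CommRingCat.ofHom ((AffinePointBlowup.translateEquiv (n := 4) (Pi.single j.succ (-h')) :
          A 4 K ≃ₐ[K] A 4 K) : A 4 K →+* A 4 K)))).prod
        (AffineCoordBlowup.𝓘Λ 4 K (insert 0 (Fin.succ '' (T : Set (Fin 4)))))).support : Set V') := by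
  set Λ : Set (Fin (4 + 1)) := insert 0 (Fin.succ '' ((insert j T : Finset (Fin 4)) : Set (Fin 4))) with hΛ
  set Cf : K → Scheme.IdealSheafData (P 4 K) := fun h' => (AffineCoordBlowup.𝓘Λ 4 K Λ).comap
    (Spec.map (CommRingCat.ofHom ((AffinePointBlowup.translateEquiv (n := 4) (Pi.single j.succ (-h')) : A 4 K ≃ₐ[K] A 4 K) :
      A 4 K →+* A 4 K))) with hCf
  have heq : (hs.map Cf).prod = Cf (-a) * ((hs.erase (-a)).map Cf).prod := prod_heights_eq_mul_erase hs ha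
  rw [heq] at hτ ⊢
  have hnh : -a ∉ hs.erase (-a) := hnd.not_mem_erase
  have hdisj : Disjoint ((Cf (-a)).support : Set (P 4 K)) (((hs.erase (-a)).map Cf).prod.support : Set (P 4 K)) := disjoint_support_heights hnh
  obtain ⟨X₁, τ₁, τ₂, hτ₁, hτ₂, rfl⟩ := hτ.exists_comp_eq_of_mul
  haveI : IsLocallyNoetherian X₁ := hτ₁.isLocallyNoetherian
  haveI : IsLocallyNoetherian V' := hτ₂.isLocallyNoetherian
  rw [IsBlowup.strictTransformIdeal_comp_of_disjoint hτ₂ hdisj, IsBlowup.strictTransformIdeal_comp_of_disjoint hτ₂ hdisj]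
  refine Set.disjoint_left.mpr fun x hxD hxZ => ?_
  have hyD := mem_support_of_mem_support_strictTransformIdeal hxD
  have hyZ := mem_support_of_mem_support_strictTransformIdeal hxZ
  have hτ₁' : IsBlowup (τ₁ ≫ Spec.map (CommRingCat.ofHom ((AffinePointBlowup.translateEquiv (n := 4) (Pi.single j.succ (- -a)) :
      A 4 K ≃ₐ[K] A 4 K) : A 4 K →+* A 4 K))) (AffineCoordBlowup.𝓘Λ 4 K Λ) := isBlowup_comp_spec_translate hτ₁
  have hZeq : strictTransformIdeal τ₁ (Cf (-a)) (AffineCoordBlowup.𝓘Λ 4 K (insert 0 (Fin.succ '' (T : Set (Fin 4))))) =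
      strictTransformIdeal (τ₁ ≫ Spec.map (CommRingCat.ofHom ((AffinePointBlowup.translateEquiv (n := 4) (Pi.single j.succ (- -a)) :
        A 4 K ≃ₐ[K] A 4 K) : A 4 K →+* A 4 K))) (AffineCoordBlowup.𝓘Λ 4 K Λ) (AffineCoordBlowup.𝓘Λ 4 K (insert 0 (Fin.succ '' (T : Set (Fin 4))))) := by
    rw [strictTransformIdeal_comp_base, comap_spec_translate_𝓘Λ_centre hjT]
  have hchart : τ₂ x ∈ Set.range (AffineCoordBlowup.chartImm hτ₁' (succ_mem_centreVars (Finset.mem_insert_self j T))) := by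
    have h1 : τ₂ x ∈ ((strictTransformIdeal (τ₁ ≫ Spec.map (CommRingCat.ofHom ((AffinePointBlowup.translateEquiv (n := 4)
        (Pi.single j.succ (- -a)) : A 4 K ≃ₐ[K] A 4 K) : A 4 K →+* A 4 K))) (AffineCoordBlowup.𝓘Λ 4 K Λ)
        (AffineCoordBlowup.𝓘Λ 4 K (insert 0 (Fin.succ '' (T : Set (Fin 4)))))).support : Set X₁) := by
      rw [← hZeq]; exact hyZ
    exact support_strictTransform_escapingCentre_after_farRepair_subset hτ₁' h1
  obtain ⟨y, hy⟩ := hchart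
  -- on the chart the hyperplane reads `⊤`
  have hyD' : y ∈ ((⊤ : Scheme.IdealSheafData (P 4 K)).support : Set (P 4 K)) := by
    rw [← strictTransform_hyperplane_j_height_self hτ₁ (show a + -a = 0 from add_neg_cancel a)]
    exact (mem_support_comap_iff _ _ y).mpr (hy ▸ hyD)
  rw [Scheme.IdealSheafData.support_top] at hyD'
  exact hyD'

end Model

/-! ## §2 On the stage `W` (pair-list boundary) -/

section Stage

variable {K : Type} [Field K] {p : ℕ} [hp : Fact p.Prime] [CharP K p]
  {S S' : Finset (Fin 4)} {j : Fin 4} {b : Fin 4 → K} {Θⱼ : A 4 K ≃ₐ[K] A 4 K} {h : MvPolynomial (Fin 4) K}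
  {F F₁ : MvPolynomial (Fin 4) K} {W : Scheme.{0}} {π : W ⟶ P 4 K}

/-- **ON `W`: A FAR MEMBER AT A REPAIRED HEIGHT DOES NOT MEET THE NEW CENTRE.** Setting of p720641; `(k, d)` a far pair (`k ∈ S ∩ S'`, `k ≠ j`,
`d ≠ 0`, `b_k ≠ 0`) resonant at some `h ∈ hs` (`d + b_k·h = 0`); `τ` ANY blowing up of `W` along `C_W`. Then the strict transform of the member
`St_π V(x_k + d)` misses `St_τ(Zc)` everywhere on `W″`. -/
theorem disjoint_support_strictTransform_resonant_W_pairs [IsAlgClosed K] [DecidableEq K] (hj : j ∈ S) (hjS' : j ∉ S') (hbj : b j = 0)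
    (h0j : Θⱼ (X 0) = X 0 + rename Fin.succ h) (hsj : ∀ i : Fin 4, Θⱼ (X i.succ) = X i.succ + C (b i))
    (hπ : IsBlowup π (AffineCoordBlowup.𝓘Λ 4 K (insert 0 (Fin.succ '' (S : Set (Fin 4))))))
    (hperm : (p : ℕ∞) ≤ CentreBlowup.ordAlong S F)
    (hread : Θⱼ (coordBlowupSubst K (insert 0 (Fin.succ '' (S : Set (Fin 4)))) j.succ (hyp p F)) = X j.succ ^ p * hyp p F₁)
    (hperm' : (p : ℕ∞) ≤ CentreBlowup.ordAlong S' F₁)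
    (hs : List K) (hne : hs ≠ []) (hnd : hs.Nodup) (h0 : ∀ h' ∈ hs, h' ≠ 0)
    {k : Fin 4} (hkS : k ∈ S) (hkS' : k ∈ S') {d : K} (hd : d ≠ 0) (hbk : b k ≠ 0) {hr : K} (hhr : hr ∈ hs) (hres : d + b k * hr = 0) :
    haveI : IsIso (CommRingCat.ofHom (Θⱼ : A 4 K →+* A 4 K)) := (inferInstance : IsIso Θⱼ.toRingEquiv.toCommRingCatIso.hom)
    let φⱼ := Spec.map (CommRingCat.ofHom (Θⱼ : A 4 K →+* A 4 K)) ≫ AffineCoordBlowup.chartImm hπ (succ_mem_centreVars hj)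
    let Zc := vanishingIdeal (closureImage φⱼ ((AffineCoordBlowup.𝓘Λ 4 K (insert 0 (Fin.succ '' (S' : Set (Fin 4))))).support : Set (P 4 K)))
    let Cmod := (hs.map fun h' => (AffineCoordBlowup.𝓘Λ 4 K (insert 0 (Fin.succ '' ((insert j S' : Finset (Fin 4)) : Set (Fin 4))))).comap
      (Spec.map (CommRingCat.ofHom ((AffinePointBlowup.translateEquiv (n := 4) (Pi.single j.succ (-h')) : A 4 K ≃ₐ[K] A 4 K) :
        A 4 K →+* A 4 K)))).prod
    let CW := vanishingIdeal (closureImage φⱼ (Cmod.support : Set (P 4 K)))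
    ∀ ⦃W'' : Scheme.{0}⦄ ⦃τ : W'' ⟶ W⦄, IsBlowup τ CW →
      Disjoint
        ((strictTransformIdeal τ CW (strictTransformIdeal π (AffineCoordBlowup.𝓘Λ 4 K (insert 0 (Fin.succ '' (S : Set (Fin 4)))))
          (ofIdealTop (Ideal.span {(γ 4 K).symm (X k.succ + C d)})))).support : Set W'')
        ((strictTransformIdeal τ CW Zc).support : Set W'') := by
  intro φⱼ Zc Cmod CW W'' τ hτ
  classical
  haveI hisoj : IsIso (CommRingCat.ofHom (Θⱼ : A 4 K →+* A 4 K)) := (inferInstance : IsIso Θⱼ.toRingEquiv.toCommRingCatIso.hom)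
  haveI : IsOpenImmersion φⱼ := inferInstanceAs (IsOpenImmersion
    (Spec.map (CommRingCat.ofHom (Θⱼ : A 4 K →+* A 4 K)) ≫ AffineCoordBlowup.chartImm hπ (succ_mem_centreVars hj)))
  haveI : IsProper π := hπ.isProper
  haveI : IsLocallyNoetherian W := LocallyOfFiniteType.isLocallyNoetherian π
  haveI : IsLocallyNoetherian W'' := hτ.isLocallyNoetherian
  have hkj : k ≠ j := fun e => hjS' (e ▸ hkS')
  obtain ⟨hcomap, -, -, -, -, -⟩ := farRepairCentre_package_pairs hj hjS' hbj h0j hsj hπ hperm hread hperm' [] hs hne hnd h0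
  have hZc : Zc.comap φⱼ = AffineCoordBlowup.𝓘Λ 4 K (insert 0 (Fin.succ '' (S' : Set (Fin 4)))) := comap_globalCentre _ _
  -- the member read on the chart: the natural-frame far quadric
  have hD : (strictTransformIdeal π (AffineCoordBlowup.𝓘Λ 4 K (insert 0 (Fin.succ '' (S : Set (Fin 4)))))
      (ofIdealTop (Ideal.span {(γ 4 K).symm (X k.succ + C d)}))).comap φⱼ =
      ofIdealTop (Ideal.span {(γ 4 K).symm ((X k.succ + C (b k)) * X j.succ - C (0 : K) * X k.succ + C d)}) := by
    have e : ((X k.succ + C (b k)) * (X j.succ + C (b j)) + C d : A 4 K) = (X k.succ + C (b k)) * X j.succ - C (0 : K) * X k.succ + C d := by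
      rw [hbj, C_0, add_zero, zero_mul, sub_zero]
    rw [← e]
    exact comap_recenter_chart_strictTransform_far hj hkS hkj hd hsj hπ
  refine Set.disjoint_left.mpr fun x hxD hxZ => ?_
  have hwD := mem_support_of_mem_support_strictTransformIdeal hxD
  have hwZ := mem_support_of_mem_support_strictTransformIdeal hxZ
  -- the point `τ x` lies over `{x_k = −d}`, hence in the `x_k`-chart, hence (being on `Zc`, `k ∈ S' ∩ S`) in the `x_j`-chart
  have hπw : (X k.succ + C d : A 4 K) ∈ (π (τ x)).asIdeal :=
    (mem_support_ofIdealTop_span_γ_symm_iff _ _).mp (mem_support_of_mem_support_strictTransformIdeal hwD)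
  have hXk : (X k.succ : A 4 K) ∉ (π (τ x)).asIdeal := fun hX => by
    have h1 := (π (τ x)).asIdeal.sub_mem hπw hX
    rw [add_sub_cancel_left, C_mem_asIdeal_iff] at h1
    exact hd h1
  have hwj : τ x ∈ Set.range φⱼ := by
    change τ x ∈ Set.range (Spec.map (CommRingCat.ofHom (Θⱼ : A 4 K →+* A 4 K)) ≫ AffineCoordBlowup.chartImm hπ (succ_mem_centreVars hj))
    rw [range_specMap_comp_chartImm]
    have hwk := mem_opensRange_chartImm_of_X_not_mem hπ (succ_mem_centreVars hkS) hXk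
    obtain ⟨Htw, hHtw⟩ := exists_lift_twist hj hbj h0j hsj hperm hread hperm'
    have hZeq := strictTransformIdeal_graph_eq_globalCentre hj hjS' hbj h0j hsj hπ hHtw
    have hwZ' := hwZ
    change τ x ∈ (Zc.support : Set W) at hwZ'
    rw [show Zc = _ from hZeq.symm] at hwZ'
    exact support_strictTransformIdeal_graph_inter_opensRange_subset hj hjS' (Finset.mem_inter.mpr ⟨hkS', hkS⟩) hπ Htw ⟨hwZ', hwk⟩
  -- hence `x` lies in the model over the chart, where the model statement applies
  have hxU : x ∈ Set.range (τ ⁻¹ᵁ φⱼ.opensRange).ι := by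
    rw [Scheme.Opens.range_ι]
    show τ x ∈ (φⱼ.opensRange : Set W)
    rw [Scheme.Hom.coe_opensRange]
    exact hwj
  obtain ⟨x', rfl⟩ := hxU
  have hτV := isBlowup_morphismRestrict_comp_isoOpensRange_inv φⱼ hτ
  rw [hcomap] at hτV
  have hx'D := (mem_support_comap_iff _ _ x').mpr hxD
  have hx'Z := (mem_support_comap_iff _ _ x').mpr hxZ
  rw [← strictTransformIdeal_model φⱼ, hcomap, hD] at hx'D
  rw [← strictTransformIdeal_model φⱼ, hcomap, hZc] at hx'Z
  exact (disjoint_support_strictTransform_resonant_heights hjS' hs hnd hhr hkS' hbk hres hτV).le_bot ⟨hx'D, hx'Z⟩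

/-- **ON `W`: THE INDEX-`j` FAR HYPERPLANE AT A REPAIRED HEIGHT DOES NOT MEET THE NEW CENTRE**: far pair `(j, c)`, `c ≠ 0`, `−c ∈ hs`. -/
theorem disjoint_support_strictTransform_farHyperplane_W_pairs [IsAlgClosed K] [DecidableEq K] (hj : j ∈ S) (hjS' : j ∉ S') (hbj : b j = 0)
    (h0j : Θⱼ (X 0) = X 0 + rename Fin.succ h) (hsj : ∀ i : Fin 4, Θⱼ (X i.succ) = X i.succ + C (b i))
    (hπ : IsBlowup π (AffineCoordBlowup.𝓘Λ 4 K (insert 0 (Fin.succ '' (S : Set (Fin 4))))))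
    (hperm : (p : ℕ∞) ≤ CentreBlowup.ordAlong S F)
    (hread : Θⱼ (coordBlowupSubst K (insert 0 (Fin.succ '' (S : Set (Fin 4)))) j.succ (hyp p F)) = X j.succ ^ p * hyp p F₁)
    (hperm' : (p : ℕ∞) ≤ CentreBlowup.ordAlong S' F₁)
    (hs : List K) (hne : hs ≠ []) (hnd : hs.Nodup) (h0 : ∀ h' ∈ hs, h' ≠ 0) {c : K} (hc : c ≠ 0) (hcs : -c ∈ hs) :
    haveI : IsIso (CommRingCat.ofHom (Θⱼ : A 4 K →+* A 4 K)) := (inferInstance : IsIso Θⱼ.toRingEquiv.toCommRingCatIso.hom)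
    let φⱼ := Spec.map (CommRingCat.ofHom (Θⱼ : A 4 K →+* A 4 K)) ≫ AffineCoordBlowup.chartImm hπ (succ_mem_centreVars hj)
    let Zc := vanishingIdeal (closureImage φⱼ ((AffineCoordBlowup.𝓘Λ 4 K (insert 0 (Fin.succ '' (S' : Set (Fin 4))))).support : Set (P 4 K)))
    let Cmod := (hs.map fun h' => (AffineCoordBlowup.𝓘Λ 4 K (insert 0 (Fin.succ '' ((insert j S' : Finset (Fin 4)) : Set (Fin 4))))).comap
      (Spec.map (CommRingCat.ofHom ((AffinePointBlowup.translateEquiv (n := 4) (Pi.single j.succ (-h')) : A 4 K ≃ₐ[K] A 4 K) :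
        A 4 K →+* A 4 K)))).prod
    let CW := vanishingIdeal (closureImage φⱼ (Cmod.support : Set (P 4 K)))
    ∀ ⦃W'' : Scheme.{0}⦄ ⦃τ : W'' ⟶ W⦄, IsBlowup τ CW →
      Disjoint
        ((strictTransformIdeal τ CW (strictTransformIdeal π (AffineCoordBlowup.𝓘Λ 4 K (insert 0 (Fin.succ '' (S : Set (Fin 4)))))
          (ofIdealTop (Ideal.span {(γ 4 K).symm (X j.succ + C c)})))).support : Set W'')
        ((strictTransformIdeal τ CW Zc).support : Set W'') := by
  intro φⱼ Zc Cmod CW W'' τ hτ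
  classical
  haveI hisoj : IsIso (CommRingCat.ofHom (Θⱼ : A 4 K →+* A 4 K)) := (inferInstance : IsIso Θⱼ.toRingEquiv.toCommRingCatIso.hom)
  haveI : IsOpenImmersion φⱼ := inferInstanceAs (IsOpenImmersion
    (Spec.map (CommRingCat.ofHom (Θⱼ : A 4 K →+* A 4 K)) ≫ AffineCoordBlowup.chartImm hπ (succ_mem_centreVars hj)))
  haveI : IsProper π := hπ.isProper
  haveI : IsLocallyNoetherian W := LocallyOfFiniteType.isLocallyNoetherian π
  haveI : IsLocallyNoetherian W'' := hτ.isLocallyNoetherian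
  obtain ⟨hcomap, -, -, -, -, -⟩ := farRepairCentre_package_pairs hj hjS' hbj h0j hsj hπ hperm hread hperm' [] hs hne hnd h0
  have hZc : Zc.comap φⱼ = AffineCoordBlowup.𝓘Λ 4 K (insert 0 (Fin.succ '' (S' : Set (Fin 4)))) := comap_globalCentre _ _
  have hD : (strictTransformIdeal π (AffineCoordBlowup.𝓘Λ 4 K (insert 0 (Fin.succ '' (S : Set (Fin 4)))))
      (ofIdealTop (Ideal.span {(γ 4 K).symm (X j.succ + C c)}))).comap φⱼ = ofIdealTop (Ideal.span {(γ 4 K).symm (X j.succ + C c)}) := by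
    have e := comap_recenter_chart_strictTransform_far_self hj hc hsj hπ
    rw [hbj, zero_add] at e
    exact e
  refine Set.disjoint_left.mpr fun x hxD hxZ => ?_
  have hwD := mem_support_of_mem_support_strictTransformIdeal hxD
  -- the point `τ x` lies over `{x_j = −c}`, hence in the `x_j`-chart
  have hπw : (X j.succ + C c : A 4 K) ∈ (π (τ x)).asIdeal :=
    (mem_support_ofIdealTop_span_γ_symm_iff _ _).mp (mem_support_of_mem_support_strictTransformIdeal hwD)
  have hXj : (X j.succ : A 4 K) ∉ (π (τ x)).asIdeal := fun hX => by
    have h1 := (π (τ x)).asIdeal.sub_mem hπw hX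
    rw [add_sub_cancel_left, C_mem_asIdeal_iff] at h1
    exact hc h1
  have hwj : τ x ∈ Set.range φⱼ := by
    change τ x ∈ Set.range (Spec.map (CommRingCat.ofHom (Θⱼ : A 4 K →+* A 4 K)) ≫ AffineCoordBlowup.chartImm hπ (succ_mem_centreVars hj))
    rw [range_specMap_comp_chartImm]
    exact mem_opensRange_chartImm_of_X_not_mem hπ (succ_mem_centreVars hj) hXj
  have hxU : x ∈ Set.range (τ ⁻¹ᵁ φⱼ.opensRange).ι := by
    rw [Scheme.Opens.range_ι]
    show τ x ∈ (φⱼ.opensRange : Set W)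
    rw [Scheme.Hom.coe_opensRange]
    exact hwj
  obtain ⟨x', rfl⟩ := hxU
  have hτV := isBlowup_morphismRestrict_comp_isoOpensRange_inv φⱼ hτ
  rw [hcomap] at hτV
  have hx'D := (mem_support_comap_iff _ _ x').mpr hxD
  have hx'Z := (mem_support_comap_iff _ _ x').mpr hxZ
  rw [← strictTransformIdeal_model φⱼ, hcomap, hD] at hx'D
  rw [← strictTransformIdeal_model φⱼ, hcomap, hZc] at hx'Z
  exact (disjoint_support_strictTransform_farHyperplane_heights hjS' hs hnd hcs hτV).le_bot ⟨hx'D, hx'Z⟩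

end Stage

end ChartDictionary

end Summit.ResolutionOfSingularities.ResolutionOfSingularities.Theorems.PIDim4

end
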